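import Mathlib.Topology.Algebra.OpenSubgroup
import Literature.AnabelianGeometry.SemiGraphs.TemperedReconstructionReductionsProofs
import Literature.AnabelianGeometry.SemiGraphs.TemperedReconstructionVertexMapProofs
import Literature.AnabelianGeometry.SemiGraphs.TemperedVerticialDistinctSameVertex
import HarnessLib

/-!
# Semi-graphs of anabelioids, §3: Corollary 3.9 (b), uniqueness — the vertex homomorphisms are
# determined up to conjugation

Mochizuki, *Semi-graphs of anabelioids*, Publ. RIMS **42** (2006), §3, Corollary 3.9, manuscript
pp. 42–43, with Remark 2.4.2 p. 26 [cite: MochizukiSemiAnbd2006, Cor 3.9 pp.42-43]: the locally open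
morphism inducing a given quasi-geometric `φ` is unique — on underlying semi-graphs
(`compatible_vertexMap_eq`, `CompatibleEdgeMapUnique_of`), "the morphism of semi-graphs of
anabelioids itself being determined up to the conjugation indeterminacy of Rmk. 2.4.2" (the typed
`Cor39`'s docstring).  Proof-only: the VERTEX-GROUP part of the latter — two vertex homomorphisms
`θ, θ′ : Π_v → Π_w` with open image that are both compatible with `φ` through verticial
homomorphisms (`φ ∘ ψ_v = γ_g ∘ ψ_w ∘ θ = γ_{g′} ∘ ψ_w ∘ θ′`) differ by an inner automorphism of
`Π_w` (`vertexHom_conj_of_compat`).  Ingredients: `ψ_w` is a homeomorphism onto the compact verticial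
subgroup `K = ψ_w(Π_w)`, so `ψ_w(θ(Π_v))` is open, of finite index, in `K`; it lies in `K ∩ kKk⁻¹`
(`k = g⁻¹g′`), whence `k ∈ K` by commensurable terminality (Thm. 3.7 (ii), clause 2,
`verticialDistinct_holds`); conclude by the injectivity of `ψ_w` (Thm. 3.7 (i)).
Nothing here takes a side on [IUTchIII] Cor. 3.12.
-/

open CategoryTheory Topology

namespace Literature.AnabelianGeometry.SemiGraphs

namespace ProfiniteSemiGraph

universe u

variable {ℋ : ProfiniteSemiGraph.{u}}

/-- The image of an open subgroup under an injective continuous homomorphism from a compact group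
has finite index in the image of the whole group (the homomorphism is a homeomorphism onto its
image). [folklore] -/
private theorem relIndex_map_ne_zero {A Γ : Type u} [Group A] [TopologicalSpace A] [CompactSpace A]
    [Group Γ] [TopologicalSpace Γ] [IsTopologicalGroup Γ] [T2Space Γ] (j : A →* Γ)
    (hjc : Continuous j) (hj : Function.Injective j) (U : Subgroup A) (hU : IsOpen (U : Set A)) :
    (U.map j).relIndex ((⊤ : Subgroup A).map j) ≠ 0 := by
  have hm : MapsOntoOpenSubgroupOf j U ((⊤ : Subgroup A).map j) :=
    mapsOntoOpenSubgroupOf_of_eq_map j hjc hj j U U hU rfl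
  have hc : IsCompact (((⊤ : Subgroup A).map j : Subgroup Γ) : Set Γ) := by
    rw [Subgroup.coe_map, Subgroup.coe_top]
    exact isCompact_univ.image hjc
  exact relIndex_ne_zero_of_mapsOnto j hc hm

/-- **Cor. 3.9 (b), uniqueness up to conjugation at a vertex** ([SemiAnbd] pp. 42–43 with
Rmk. 2.4.2 p. 26): if `θ, θ′ : Π_v → Π_w` have open image and `φ ∘ ψ_v` is conjugate both to
`ψ_w ∘ θ` and to `ψ_w ∘ θ′` for verticial homomorphisms `ψ_v` (at `v`) and `ψ_w` (at `w`), then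
`θ = γ_κ ∘ θ′` for some `κ ∈ Π_w`. [cite: MochizukiSemiAnbd2006, Cor 3.9 pp.42-43] -/
theorem vertexHom_conj_of_compat (h37i : VerticialInjective.{u}) (hℋ : ℋ.Thm37Hypotheses)
    (cℋ : TemperedPiChart ℋ) {P V : Type u} [Group P] [Group V] (φ : P →* cℋ.G) (ψ : V →* P)
    {w : ℋ.graph.Vertex} {ψ' : ℋ.Gv w →ₜ* cℋ.G} (hψ' : IsVerticialHom cℋ w ψ')
    (θ θ' : V →* ℋ.Gv w) (hθ : IsOpen (θ.range : Set (ℋ.Gv w))) {g g' : cℋ.G}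
    (hg : ∀ x, φ (ψ x) = g * ψ' (θ x) * g⁻¹) (hg' : ∀ x, φ (ψ x) = g' * ψ' (θ' x) * g'⁻¹) :
    ∃ κ : ℋ.Gv w, ∀ x, θ x = κ * θ' x * κ⁻¹ := by
  haveI := cℋ.t2Space
  have hinj : Function.Injective ψ' := (h37i ℋ hℋ cℋ w).2 ψ' hψ'
  set k : cℋ.G := g⁻¹ * g' with hk
  -- `ψ'(θ x) = k ψ'(θ' x) k⁻¹`
  have hrel : ∀ x, ψ' (θ x) = k * ψ' (θ' x) * k⁻¹ := by
    intro x
    have h1 := (hg x).symm.trans (hg' x)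
    -- `g ψ'(θ x) g⁻¹ = g' ψ'(θ' x) g'⁻¹`
    have : ψ' (θ x) = g⁻¹ * (g' * ψ' (θ' x) * g'⁻¹) * g := by
      rw [← h1]; group
    rw [this, hk]; group
  -- `K = ψ'(Π_w)`; `ψ'(θ(V)) ≤ K ∩ k K k⁻¹` has finite index in `K`
  let K : Subgroup cℋ.G := ψ'.toMonoidHom.range
  have hK : K ∈ verticialSubgroups cℋ w := ⟨ψ', hψ', rfl⟩
  have hle : (θ.range).map ψ'.toMonoidHom ≤ K ⊓ K.map (MulAut.conj k).toMonoidHom := by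
    rintro _ ⟨_, ⟨x, rfl⟩, rfl⟩
    refine ⟨⟨θ x, rfl⟩, ⟨ψ' (θ' x), ⟨θ' x, rfl⟩, ?_⟩⟩
    change k * ψ' (θ' x) * k⁻¹ = ψ'.toMonoidHom (θ x)
    exact (hrel x).symm
  have htop : K = (⊤ : Subgroup (ℋ.Gv w)).map ψ'.toMonoidHom := (MonoidHom.range_eq_map _)
  have hfi : ((θ.range).map ψ'.toMonoidHom).relIndex K ≠ 0 := by
    rw [htop]
    exact relIndex_map_ne_zero ψ'.toMonoidHom ψ'.continuous hinj θ.range hθ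
  have hne : (K.map (MulAut.conj k).toMonoidHom).relIndex K ≠ 0 := fun h0 =>
    hfi (Subgroup.relIndex_eq_zero_of_le_left (hle.trans inf_le_right) h0)
  -- commensurable terminality: `k ∈ K`
  have hkK : k ∈ K := by
    by_contra hk'
    have h0 := (verticialDistinct_holds ℋ hℋ cℋ).2 w K hK 1 k (by simpa using hk')
    have h1 : K.map (MulAut.conj (1 : cℋ.G)).toMonoidHom = K := by ext x; simp
    rw [h1] at h0
    exact hne h0
  obtain ⟨κ, hκ⟩ := hkK
  refine ⟨κ, fun x => hinj ?_⟩
  rw [map_mul, map_mul, map_inv, hrel x]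
  change k * ψ' (θ' x) * k⁻¹ = ψ'.toMonoidHom κ * ψ' (θ' x) * (ψ'.toMonoidHom κ)⁻¹
  rw [hκ]

/-- **Two compatible locally open morphisms agree on vertex groups up to conjugation** (Cor. 3.9 (b)
uniqueness, vertex part; Rmk. 2.4.2): for `F`, `F′` locally open with `F.CompatV φ` and `F′.CompatV φ`
and a vertex `v` with `F v = F′ v =: w` — stated for vertex homomorphisms `θ := F_v`, `θ′ := F′_v`
into the same `Π_w` — `F_v = γ_κ ∘ F′_v` for some `κ ∈ Π_w`.  (Use with `compatible_vertexMap_eq`,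
which gives `F v = F′ v`.) [cite: MochizukiSemiAnbd2006, Cor 3.9 pp.42-43] -/
theorem vertexHom_conj_of_compatV (h37i : VerticialInjective.{u}) (hℋ : ℋ.Thm37Hypotheses)
    {𝒢 : ProfiniteSemiGraph.{u}} (h𝒢v : ∀ v : 𝒢.graph.Vertex, ∀ c : TemperedPiChart 𝒢,
      (verticialSubgroups c v).Nonempty)
    (c𝒢 : TemperedPiChart 𝒢) (cℋ : TemperedPiChart ℋ) (φ : c𝒢.G →ₜ* cℋ.G) (v : 𝒢.graph.Vertex)
    {w : ℋ.graph.Vertex} (θ θ' : 𝒢.Gv v →ₜ* ℋ.Gv w)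
    (hθ : IsOpen (θ.toMonoidHom.range : Set (ℋ.Gv w)))
    (hc : ∀ (ψ : 𝒢.Gv v →ₜ* c𝒢.G) (ψ' : ℋ.Gv w →ₜ* cℋ.G), IsVerticialHom c𝒢 v ψ →
      IsVerticialHom cℋ w ψ' → ∃ g : cℋ.G, ∀ x, φ (ψ x) = g * ψ' (θ x) * g⁻¹)
    (hc' : ∀ (ψ : 𝒢.Gv v →ₜ* c𝒢.G) (ψ' : ℋ.Gv w →ₜ* cℋ.G), IsVerticialHom c𝒢 v ψ →
      IsVerticialHom cℋ w ψ' → ∃ g : cℋ.G, ∀ x, φ (ψ x) = g * ψ' (θ' x) * g⁻¹) :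
    ∃ κ : ℋ.Gv w, ∀ x, θ x = κ * θ' x * κ⁻¹ := by
  obtain ⟨_, ψ, hψ, rfl⟩ := h𝒢v v c𝒢
  obtain ⟨⟨_, ψ', hψ', rfl⟩, -⟩ := h37i ℋ hℋ cℋ w
  obtain ⟨g, hg⟩ := hc ψ ψ' hψ hψ'
  obtain ⟨g', hg'⟩ := hc' ψ ψ' hψ hψ'
  exact vertexHom_conj_of_compat h37i hℋ cℋ φ.toMonoidHom ψ.toMonoidHom hψ' θ.toMonoidHom
    θ'.toMonoidHom hθ hg hg'

end ProfiniteSemiGraph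

end Literature.AnabelianGeometry.SemiGraphs
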